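import Mathlib
import Summits.ValiantsHypothesis.ValiantsHypothesis.Theorems.NewtonUnitEquationsNewtonTauWeakAutomatonGenDefs

/-!
# `NewtonUnitEquationsNewtonTauWeakAutomatonGenSupport` — general carry automaton: support in the double box

Rung toward the crux `NewtonTauWeak` (stmt-ValiantsHypothesis-5904), line `binomial-normal-form`, THEOREM B
(general carry automaton: digit-scaled level polynomials of degree `≤ C` in each variable): registered stub
`stub_genSupport`, the generalisation of `stub_autoSupport` (`…AutomatonSupport.lean`, digit hexagon).

Claim.  If every level polynomial `G l i` has degree `≤ C` in each variable, then every exponent `e` in the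
support of `genSum k n c G = Σ_l c_l · Π_{i<n} G_{l,i}(x^{2^i}, y^{2^i})` satisfies `e 0 < 2^n (C+1)` and
`e 1 < 2^n (C+1)` (hypothesis `hsupp` of `stub_autoGreedyGen`).

Proof.  Partial degrees (`MvPolynomial.degreeOf`): `degreeOf j (G l i) ≤ C` (`degreeOf_le_iff`); expanding by
`2^i` multiplies every exponent vector by `2^i` (`MvPolynomial.support_expand_subset`), so
`degreeOf j (expand (2^i) (G l i)) ≤ 2^i C`; the `n`-level product has `degreeOf j ≤ Σ_{i<n} 2^i C = 2^n C - C`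
(`degreeOf_prod_le`, geometric sum by induction); a scalar multiple does not increase it (`degreeOf_C_mul_le`),
nor does the sum over the `k` products (`degreeOf_sum_le`, `Finset.sup_le`); finally
`e j ≤ degreeOf j ≤ 2^n C - C < 2^n (C+1)` for `e` in the support (`monomial_le_degreeOf`). [folklore]
-/

set_option linter.dupNamespace false

noncomputable section

open scoped BigOperators
open MvPolynomial

namespace Summit.ValiantsHypothesis.ValiantsHypothesis.Theorems.NewtonTauWeakAutomaton

namespace GenSupportAux

/-- Expanding by `p` multiplies a partial-degree bound by `p`: if `degreeOf j φ ≤ d` then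
`degreeOf j (expand p φ) ≤ p d` (every exponent vector of `expand p φ` is `p •` one of `φ`). [folklore] -/
theorem degreeOf_expand_le (j : Fin 2) (p d : ℕ) (φ : MvPolynomial (Fin 2) ℂ) (h : degreeOf j φ ≤ d) :
    degreeOf j (expand p φ) ≤ p * d := by
  rw [degreeOf_le_iff] at h ⊢
  intro m hm
  obtain ⟨a, ha, rfl⟩ := Finset.mem_image.mp (support_expand_subset φ hm)
  simp only [Finsupp.smul_apply, smul_eq_mul]
  exact Nat.mul_le_mul_left p (h a ha)

/-- A level polynomial whose exponents are `≤ C` in both coordinates has partial degree `≤ C` in each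
variable. -/
theorem degreeOf_level_le (j : Fin 2) (C : ℕ) (φ : MvPolynomial (Fin 2) ℂ)
    (h : ∀ e ∈ φ.support, e 0 ≤ C ∧ e 1 ≤ C) : degreeOf j φ ≤ C := by
  rw [degreeOf_le_iff]
  intro m hm
  fin_cases j
  · exact (h m hm).1
  · exact (h m hm).2

/-- The geometric sum `Σ_{i<n} 2^i C + C = 2^n C`. -/
theorem sum_two_pow_mul_add (n C : ℕ) : ∑ i ∈ Finset.range n, 2 ^ i * C + C = 2 ^ n * C := by
  induction n with
  | zero => simp
  | succ n ih =>
    rw [Finset.sum_range_succ, pow_succ', mul_assoc]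
    omega

/-- An `n`-level digit-scaled product of level polynomials of partial degrees `≤ C` has partial degree at most
`2^n C - C` in each variable. [folklore] -/
theorem degreeOf_genProd_add_le (j : Fin 2) (C : ℕ) (G : ℕ → MvPolynomial (Fin 2) ℂ)
    (hG : ∀ i, ∀ e ∈ (G i).support, e 0 ≤ C ∧ e 1 ≤ C) (n : ℕ) :
    degreeOf j (genProd G n) + C ≤ 2 ^ n * C := by
  unfold genProd
  rw [← sum_two_pow_mul_add n C]
  refine Nat.add_le_add_right
    ((degreeOf_prod_le j (Finset.range n) fun i => expand (2 ^ i) (G i)).trans ?_) C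
  exact Finset.sum_le_sum fun i _ =>
    degreeOf_expand_le j (2 ^ i) C (G i) (degreeOf_level_le j C (G i) (hG i))

/-- The `k`-sum of scalar multiples of `n`-level digit-scaled products (level polynomials of partial degrees
`≤ C`) has partial degree at most `2^n C - C` in each variable. [folklore] -/
theorem degreeOf_genSum_add_le (j : Fin 2) (k C n : ℕ) (c : Fin k → ℂ)
    (G : Fin k → ℕ → MvPolynomial (Fin 2) ℂ) (hG : ∀ l i, ∀ e ∈ (G l i).support, e 0 ≤ C ∧ e 1 ≤ C) :
    degreeOf j (genSum k n c G) + C ≤ 2 ^ n * C := by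
  have hpos : C ≤ 2 ^ n * C := Nat.le_mul_of_pos_left C (Nat.two_pow_pos n)
  unfold genSum
  have hsup : (Finset.univ.sup fun l : Fin k => degreeOf j (MvPolynomial.C (c l) * genProd (G l) n)) ≤
      2 ^ n * C - C := by
    refine Finset.sup_le fun l _ => (degreeOf_C_mul_le _ _ _).trans ?_
    have := degreeOf_genProd_add_le j C (G l) (hG l) n
    omega
  have := (degreeOf_sum_le j Finset.univ fun l : Fin k => MvPolynomial.C (c l) * genProd (G l) n).trans hsup
  omega

end GenSupportAux

open GenSupportAux in
/-- **Support of a general digit-scaled sum lies in the double box.**  If every level polynomial `G l i` has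
degree `≤ C` in each variable, then every exponent vector `e` in the support of
`genSum k n c G = Σ_l c_l · Π_{i<n} G_{l,i}(x^{2^i}, y^{2^i})` satisfies `e 0 < 2^n (C+1)` and `e 1 < 2^n (C+1)`
(indeed `≤ 2^n C - C`: expanding by `2^i` scales the partial degrees by `2^i`, and `Σ_{i<n} 2^i C = 2^n C - C`).
This is hypothesis `hsupp` of `stub_autoGreedyGen`; it generalises `stub_autoSupport` (digit hexagon).
[folklore: carry automaton / transfer matrices of digit expansions] -/
theorem stub_genSupport (k C n : ℕ) (c : Fin k → ℂ) (G : Fin k → ℕ → MvPolynomial (Fin 2) ℂ)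
    (hG : ∀ l i, ∀ e ∈ (G l i).support, e 0 ≤ C ∧ e 1 ≤ C) :
    ∀ e ∈ (genSum k n c G).support, e 0 < 2 ^ n * (C + 1) ∧ e 1 < 2 ^ n * (C + 1) := by
  intro e he
  have key : ∀ j : Fin 2, e j < 2 ^ n * (C + 1) := by
    intro j
    have h1 : e j ≤ degreeOf j (genSum k n c G) := monomial_le_degreeOf j he
    have h2 := degreeOf_genSum_add_le j k C n c G hG
    have h3 : 2 ^ n * (C + 1) = 2 ^ n * C + 2 ^ n := by ring
    have h4 : 0 < 2 ^ n := Nat.two_pow_pos n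
    omega
  exact ⟨key 0, key 1⟩

end Summit.ValiantsHypothesis.ValiantsHypothesis.Theorems.NewtonTauWeakAutomaton

end
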